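import Summits.CriticalPhenomena.CardyFormulaZ2.Theorems.CardySelfRefinementLagHandOffRotationCorners
import HarnessLib

/-!
# The quarter turn on discrete Dobrushin data: `Ω_δ`, inner faces, boundary, arcs, boundary
conditions, medial steps, start corners, admissibility
(groundwork for stub `stub_tournamentTransfer`, line `hitting-tournament`, crux `LagHandOff`,
stmt-CriticalPhenomena-10268; registered sub-goal stub `stub_tournamentTransfer_rotationData`)

Second file of the quarter-turn covariance of G02's medial exploration (see
`…RotationCorners.lean`).  Two discrete Dobrushin data `E`, `E'` are TURNED INTO EACH OTHER when
`E'.Ω = i·E.Ω`, `E'.δ = E.δ`, `E'.arcA = i·E.arcA`, `E'.arcB = i·E.arcB` (no new definition is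
introduced; every statement carries these four equations).  Then, by the transport of the tree's
discretisation under the cell symmetry `CellSymmetry.rot` (`CellGridSaddleSymmetry.lean`:
`mem_meshDomain_cell`, `discreteDomainGraph_adj_cell`, `mem_meshBoundary_cell`; the plane action
is the isometry `z ↦ i z`, which preserves `infDist` and `frontier`):

* the graph `Ω_δ`, inner faces, face-boundary edges, the square-lattice boundary `zdBoundary`,
  the discrete arcs (`zdDiscreteArc`, `zdArcA`, `zdArcB`), the `A`–`B` edges and the completed
  configuration `bcBondConfig` of `E'` are the turned ones of `E` (`adj_rot_iff`, …,
  `bcBondConfig_rot`);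
* medial steps, sourced edges and start corners correspond (`isMedialStep_rot_iff`,
  `isOutEdge_rot_iff`, `isStartCorner_rot_iff`: the start corner `(x, k)` of `E` is carried to
  the start corner `(rotCell x, k + 1)` of `E'`), and admissibility is transported
  (`isZdAdmissible_rot`).

References: S. Smirnov, C. R. Acad. Sci. Paris 333 (2001), §2; G. Grimmett, *Percolation*
(1999), §1.6; B. Bollobás, O. Riordan, *Percolation* (2006), Ch. 3.
-/

noncomputable section

open Set Metric
open Literature.Probability.Percolation Literature.Probability.LatticeModels

namespace Summit.CriticalPhenomena.CardyFormulaZ2.Cruxes.LagHandOff.HittingTournament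

/-! ### The tree's transport lemmas, read for `rotCell` -/

/-- The plane action of the quarter turn on sets is multiplication by `i`. [folklore] -/
theorem image_mul_I_eq_rot_plane (S : Set ℂ) :
    (fun z => Complex.I * z) '' S = CellSymmetry.rot.plane '' S :=
  (CellSymmetry.image_rot_plane S).symm

/-- `Ω_δ` is transported by the quarter turn. [cite: Smirnov2001, §2] -/
theorem mem_meshDomain_rotCell_iff {Ω : Set ℂ} {δ : ℝ} {x : Site 2} :
    rotCell x ∈ meshDomain (CellSymmetry.rot.plane '' Ω) δ ↔ x ∈ meshDomain Ω δ :=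
  CellSymmetry.rot.mem_meshDomain_cell

/-- The graph `Ω_δ` is transported by the quarter turn. [cite: Smirnov2001, §2] -/
theorem discreteDomainGraph_adj_rotCell_iff {Ω : Set ℂ} {δ : ℝ} {x y : Site 2} :
    (discreteDomainGraph (CellSymmetry.rot.plane '' Ω) δ).Adj (rotCell x) (rotCell y) ↔
      (discreteDomainGraph Ω δ).Adj x y :=
  CellSymmetry.rot.discreteDomainGraph_adj_cell

/-- The vertex boundary is transported by the quarter turn. [cite: Smirnov2001, §2] -/
theorem mem_meshBoundary_rotCell_iff {Ω : Set ℂ} {δ : ℝ} {x : Site 2} :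
    rotCell x ∈ meshBoundary (CellSymmetry.rot.plane '' Ω) δ ↔ x ∈ meshBoundary Ω δ :=
  CellSymmetry.rot.mem_meshBoundary_cell

/-- Mesh points are transported by the quarter turn. [folklore] -/
theorem meshPoint_rotCell (δ : ℝ) (x : Site 2) :
    meshPoint δ (rotCell x) = CellSymmetry.rot.plane (meshPoint δ x) :=
  CellSymmetry.rot.meshPoint_cell δ x

/-- Lattice adjacency is invariant under the quarter turn. [folklore] -/
theorem zdGraph_adj_rotCell_iff (x y : Site 2) :
    (zdGraph 2).Adj (rotCell x) (rotCell y) ↔ (zdGraph 2).Adj x y :=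
  CellSymmetry.rot.zdGraph_adj_cell x y

/-! ### Turned Dobrushin data -/

section Data

variable {E E' : DiscreteDobrushin}
  (hΩ : E'.Ω = (fun z => Complex.I * z) '' E.Ω) (hδ : E'.δ = E.δ)
  (hA : E'.arcA = (fun z => Complex.I * z) '' E.arcA)
  (hB : E'.arcB = (fun z => Complex.I * z) '' E.arcB)

include hΩ hδ

/-- The graph `Ω_δ` of the turned data is the turned graph. [cite: Smirnov2001, §2] -/
theorem adj_rot_iff (x y : Site 2) :
    (discreteDomainGraph E'.Ω E'.δ).Adj (rotCell x) (rotCell y) ↔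
      (discreteDomainGraph E.Ω E.δ).Adj x y := by
  rw [hΩ, hδ, image_mul_I_eq_rot_plane]
  exact discreteDomainGraph_adj_rotCell_iff

/-- `Ω_δ` of the turned data is the turned `Ω_δ`. [cite: Smirnov2001, §2] -/
theorem mem_meshDomain_rot_iff (x : Site 2) :
    rotCell x ∈ meshDomain E'.Ω E'.δ ↔ x ∈ meshDomain E.Ω E.δ := by
  rw [hΩ, hδ, image_mul_I_eq_rot_plane]
  exact mem_meshDomain_rotCell_iff

/-- The edges of `Ω_δ` of the turned data are the turned edges. [cite: Smirnov2001, §2] -/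
theorem rot_mem_edgeSet_data_iff (e : Sym2 (Site 2)) :
    sym2Equiv rotCell e ∈ (discreteDomainGraph E'.Ω E'.δ).edgeSet ↔
      e ∈ (discreteDomainGraph E.Ω E.δ).edgeSet := by
  induction e using Sym2.ind with
  | h x y => rw [sym2Equiv_mk, SimpleGraph.mem_edgeSet, SimpleGraph.mem_edgeSet, adj_rot_iff hΩ hδ]

/-- Inner faces of the turned data are the turned inner faces. [cite: Smirnov2001, §2] -/
theorem isInnerFace_rot_iff (f : Site 2) :
    E'.IsInnerFace (CellSymmetry.rot.face f) ↔ E.IsInnerFace f := by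
  -- adapted from `isInnerFace_shiftData_iff` of `…MedialExplorationShiftData`
  constructor
  · intro h v v' hv hv' hadj
    rw [← adj_rot_iff hΩ hδ]
    exact h _ _ ((isCorner_rot_iff v f).2 hv) ((isCorner_rot_iff v' f).2 hv')
      ((zdGraph_adj_rotCell_iff v v').2 hadj)
  · intro h v₁ v₂ hv₁ hv₂ hadj
    obtain ⟨v, rfl⟩ := rotCell.surjective v₁
    obtain ⟨v', rfl⟩ := rotCell.surjective v₂
    rw [adj_rot_iff hΩ hδ]
    exact h _ _ ((isCorner_rot_iff v f).1 hv₁) ((isCorner_rot_iff v' f).1 hv₂)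
      ((zdGraph_adj_rotCell_iff v v').1 hadj)

/-- Face-boundary edges of the turned data are the turned ones. [cite: Smirnov2001, §2] -/
theorem isFaceBoundaryEdge_rot_iff (x y : Site 2) :
    E'.IsFaceBoundaryEdge (rotCell x) (rotCell y) ↔ E.IsFaceBoundaryEdge x y := by
  constructor
  · rintro ⟨hadj, ⟨f₁, hf, hx, hy⟩, g₁, hg, hx', hy'⟩
    obtain ⟨f, rfl⟩ := CellSymmetry.rot.face.surjective f₁
    obtain ⟨g, rfl⟩ := CellSymmetry.rot.face.surjective g₁
    rw [isInnerFace_rot_iff hΩ hδ] at hf hg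
    rw [isCorner_rot_iff] at hx hy hx' hy'
    exact ⟨(adj_rot_iff hΩ hδ x y).1 hadj, ⟨f, hf, hx, hy⟩, g, hg, hx', hy'⟩
  · rintro ⟨hadj, ⟨f, hf, hx, hy⟩, g, hg, hx', hy'⟩
    exact ⟨(adj_rot_iff hΩ hδ x y).2 hadj, ⟨CellSymmetry.rot.face f,
      (isInnerFace_rot_iff hΩ hδ f).2 hf, (isCorner_rot_iff x f).2 hx, (isCorner_rot_iff y f).2 hy⟩,
      CellSymmetry.rot.face g, fun h => hg ((isInnerFace_rot_iff hΩ hδ g).1 h),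
      (isCorner_rot_iff x g).2 hx', (isCorner_rot_iff y g).2 hy'⟩

/-- The square-lattice boundary of the turned data is the turned boundary. [cite: Smirnov2001, §2] -/
theorem mem_zdBoundary_rot_iff (x : Site 2) : rotCell x ∈ E'.zdBoundary ↔ x ∈ E.zdBoundary := by
  rw [DiscreteDobrushin.mem_zdBoundary_iff, DiscreteDobrushin.mem_zdBoundary_iff]
  refine or_congr ?_ ⟨?_, ?_⟩
  · rw [hΩ, hδ, image_mul_I_eq_rot_plane]
    exact mem_meshBoundary_rotCell_iff
  · rintro ⟨y₁, hy⟩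
    obtain ⟨y, rfl⟩ := rotCell.surjective y₁
    exact ⟨y, (isFaceBoundaryEdge_rot_iff hΩ hδ x y).1 hy⟩
  · rintro ⟨y, hy⟩
    exact ⟨rotCell y, (isFaceBoundaryEdge_rot_iff hΩ hδ x y).2 hy⟩

/-- Discrete arcs of the turned data (and turned arc) are the turned discrete arcs: the metric
comparison selecting them is invariant under the isometry `z ↦ i z`. [cite: Smirnov2001, §2] -/
theorem mem_zdDiscreteArc_rot_iff (A' : Set ℂ) (x : Site 2) :
    rotCell x ∈ E'.zdDiscreteArc ((fun z => Complex.I * z) '' A') ↔ x ∈ E.zdDiscreteArc A' := by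
  rw [DiscreteDobrushin.mem_zdDiscreteArc_iff, DiscreteDobrushin.mem_zdDiscreteArc_iff,
    mem_zdBoundary_rot_iff hΩ hδ, hδ, hΩ, image_mul_I_eq_rot_plane, image_mul_I_eq_rot_plane,
    meshPoint_rotCell, CellSymmetry.rot.frontier_image_plane,
    ← Set.image_sdiff CellSymmetry.rot.plane.injective,
    Metric.infDist_image CellSymmetry.rot.plane.isometry,
    Metric.infDist_image CellSymmetry.rot.plane.isometry]

include hA in
/-- The discrete arc of `A` of the turned data is the turned one. [cite: Smirnov2001, §2] -/
theorem mem_zdArcA_rot_iff (x : Site 2) : rotCell x ∈ E'.zdArcA ↔ x ∈ E.zdArcA := by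
  rw [DiscreteDobrushin.zdArcA, DiscreteDobrushin.zdArcA, hA]
  exact mem_zdDiscreteArc_rot_iff hΩ hδ E.arcA x

include hB in
/-- The discrete arc of `B` of the turned data is the turned one. [cite: Smirnov2001, §2] -/
theorem mem_zdArcB_rot_iff (x : Site 2) : rotCell x ∈ E'.zdArcB ↔ x ∈ E.zdArcB := by
  rw [DiscreteDobrushin.zdArcB, DiscreteDobrushin.zdArcB, hB]
  exact mem_zdDiscreteArc_rot_iff hΩ hδ E.arcB x

include hA hB

/-- The `A`–`B` edges of the turned data are the turned `A`–`B` edges. [cite: Smirnov2001, §2] -/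
theorem rot_mem_zdABEdges_iff (e : Sym2 (Site 2)) :
    sym2Equiv rotCell e ∈ E'.zdABEdges ↔ e ∈ E.zdABEdges := by
  rw [DiscreteDobrushin.mem_zdABEdges_iff, DiscreteDobrushin.mem_zdABEdges_iff,
    rot_mem_edgeSet_data_iff hΩ hδ, exists_mem_rot_iff, exists_mem_rot_iff]
  simp only [mem_zdArcA_rot_iff hΩ hδ hA, mem_zdArcB_rot_iff hΩ hδ hB]

/-- The set of `A`–`B` edges of the turned data is the image of that of the data.
[cite: Smirnov2001, §2] -/
theorem zdABEdges_rot_eq : E'.zdABEdges = sym2Equiv rotCell '' E.zdABEdges := by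
  ext e₁
  obtain ⟨e, rfl⟩ := (sym2Equiv rotCell).surjective e₁
  rw [rot_mem_zdABEdges_iff hΩ hδ hA hB, (sym2Equiv rotCell).injective.mem_set_image]

/-- Imposing the boundary conditions commutes with turning data and configuration.
[cite: Smirnov2001, §2] -/
theorem bcBondConfig_rot (ω : BondConfig (Site 2)) :
    E'.bcBondConfig (BondConfig.relabel (sym2Equiv rotCell) ω) =
      BondConfig.relabel (sym2Equiv rotCell) (E.bcBondConfig ω) := by
  ext e₁
  obtain ⟨e, rfl⟩ := (sym2Equiv rotCell).surjective e₁
  rw [BondConfig.mem_relabel_iff, Equiv.symm_apply_apply, DiscreteDobrushin.mem_bcBondConfig_iff,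
    DiscreteDobrushin.mem_bcBondConfig_iff, rot_mem_edgeSet_data_iff hΩ hδ,
    BondConfig.mem_relabel_iff, Equiv.symm_apply_apply, forall_mem_rot_iff, forall_mem_rot_iff]
  simp only [mem_zdArcA_rot_iff hΩ hδ hA, mem_zdArcB_rot_iff hΩ hδ hB]

omit hA hB in
/-- Medial steps of the turned data are the turned medial steps. [cite: Smirnov2001, §2] -/
theorem isMedialStep_rot_iff (e e' : MedialVertex) :
    E'.IsMedialStep (sym2Equiv rotCell e) (sym2Equiv rotCell e') ↔ E.IsMedialStep e e' := by
  constructor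
  · rintro ⟨v₁, f₁, hc, hf, hs, ht⟩
    obtain ⟨v, rfl⟩ := rotCell.surjective v₁
    obtain ⟨f, rfl⟩ := CellSymmetry.rot.face.surjective f₁
    rw [isCorner_rot_iff] at hc
    rw [cornerSource_rot hc] at hs
    rw [cornerTarget_rot hc] at ht
    exact ⟨v, f, hc, (isInnerFace_rot_iff hΩ hδ f).1 hf, (sym2Equiv _).injective hs,
      (sym2Equiv _).injective ht⟩
  · rintro ⟨v, f, hc, hf, rfl, rfl⟩
    exact ⟨rotCell v, CellSymmetry.rot.face f, (isCorner_rot_iff v f).2 hc,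
      (isInnerFace_rot_iff hΩ hδ f).2 hf, cornerSource_rot hc, cornerTarget_rot hc⟩

omit hA hB in
/-- Sourced face-boundary edges correspond: the edge at `x` in direction `k` is sourced at `x`
in `E` iff the edge at `rotCell x` in direction `k + 1` is sourced there in the turned data.
[cite: Smirnov2001, §2] -/
theorem isOutEdge_rot_iff (x : Site 2) (k : Fin 4) :
    E'.IsOutEdge (rotCell x) (k + 1) ↔ E.IsOutEdge x k := by
  rw [DiscreteDobrushin.IsOutEdge, DiscreteDobrushin.IsOutEdge, add_right_comm k 1 3,
    faceAt_rotCell, faceAt_rotCell, isInnerFace_rot_iff hΩ hδ, isInnerFace_rot_iff hΩ hδ]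

/-- **Start corners correspond**: `(x, k)` is a start corner of `E` iff `(rotCell x, k + 1)` is
a start corner of the turned data (its source edge is the turned `e_a`). [cite: Smirnov2001, §2] -/
theorem isStartCorner_rot_iff (c : Site 2 × Fin 4) :
    E'.IsStartCorner (rotCell c.1, c.2 + 1) ↔ E.IsStartCorner c := by
  constructor
  · rintro ⟨h1, h2, h3⟩
    refine ⟨(mem_zdArcA_rot_iff hΩ hδ hA _).1 h1, (mem_zdArcB_rot_iff hΩ hδ hB _).1 ?_,
      (isOutEdge_rot_iff hΩ hδ _ _).1 h3⟩
    rwa [rotCell_add, rotCell_cornerUnit]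
  · rintro ⟨h1, h2, h3⟩
    refine ⟨(mem_zdArcA_rot_iff hΩ hδ hA _).2 h1, ?_, (isOutEdge_rot_iff hΩ hδ _ _).2 h3⟩
    have := (mem_zdArcB_rot_iff hΩ hδ hB _).2 h2
    rwa [rotCell_add, rotCell_cornerUnit] at this

/-- **Admissibility is transported**: the turned data of admissible data are admissible.
[cite: Smirnov2001, §2] -/
theorem isZdAdmissible_rot (h : E.IsZdAdmissible) : E'.IsZdAdmissible where
  isBounded := by
    rw [hΩ, image_mul_I_eq_rot_plane]
    exact CellSymmetry.rot.plane.lipschitz.isBounded_image h.isBounded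
  delta_pos := by rw [hδ]; exact h.delta_pos
  zdArcA_nonempty := by
    obtain ⟨x, hx⟩ := h.zdArcA_nonempty
    exact ⟨rotCell x, (mem_zdArcA_rot_iff hΩ hδ hA x).2 hx⟩
  zdArcB_nonempty := by
    obtain ⟨x, hx⟩ := h.zdArcB_nonempty
    exact ⟨rotCell x, (mem_zdArcB_rot_iff hΩ hδ hB x).2 hx⟩
  disjoint := by
    rw [Set.disjoint_left]
    intro y₁ hyA hyB
    obtain ⟨y, rfl⟩ := rotCell.surjective y₁
    exact Set.disjoint_left.1 h.disjoint ((mem_zdArcA_rot_iff hΩ hδ hA y).1 hyA)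
      ((mem_zdArcB_rot_iff hΩ hδ hB y).1 hyB)
  zdBoundary_subset := by
    intro y₁ hy
    obtain ⟨y, rfl⟩ := rotCell.surjective y₁
    rcases h.zdBoundary_subset ((mem_zdBoundary_rot_iff hΩ hδ y).1 hy) with hy' | hy'
    · exact Or.inl ((mem_zdArcA_rot_iff hΩ hδ hA y).2 hy')
    · exact Or.inr ((mem_zdArcB_rot_iff hΩ hδ hB y).2 hy')
  ncard_zdABEdges_eq_two := by
    rw [zdABEdges_rot_eq hΩ hδ hA hB, Set.ncard_image_of_injective _ (sym2Equiv rotCell).injective,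
      h.ncard_zdABEdges_eq_two]
  zdABEdges_inner := by
    intro e₁ he₁
    obtain ⟨e, rfl⟩ := (sym2Equiv rotCell).surjective e₁
    have he := (rot_mem_zdABEdges_iff hΩ hδ hA hB e).1 he₁
    obtain ⟨f, ⟨hf, hcf⟩, huniq⟩ := h.zdABEdges_inner e he
    refine ⟨CellSymmetry.rot.face f, ⟨(isInnerFace_rot_iff hΩ hδ f).2 hf, ?_⟩, ?_⟩
    · rw [forall_mem_rot_iff]
      exact fun x hx => (isCorner_rot_iff x f).2 (hcf x hx)
    · intro g₁ ⟨hg, hcg⟩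
      obtain ⟨g, rfl⟩ := CellSymmetry.rot.face.surjective g₁
      rw [forall_mem_rot_iff] at hcg
      rw [huniq g ⟨(isInnerFace_rot_iff hΩ hδ g).1 hg, fun x hx => (isCorner_rot_iff x g).1 (hcg x hx)⟩]

end Data

/-- **Registered sub-goal stub `stub_tournamentTransfer_rotationData`** (tree vocabulary; =
`isZdAdmissible_rot` and `isStartCorner_rot_iff`). [cite: Smirnov2001, §2] -/
theorem stub_tournamentTransfer_rotationData : ∀ (E E' : DiscreteDobrushin) (c : Site 2 × Fin 4), E'.Ω = (fun z => Complex.I * z) '' E.Ω → E'.δ = E.δ → E'.arcA = (fun z => Complex.I * z) '' E.arcA → E'.arcB = (fun z => Complex.I * z) '' E.arcB → (E.IsZdAdmissible → E'.IsZdAdmissible) ∧ (E'.IsStartCorner (rotCell c.1, c.2 + 1) ↔ E.IsStartCorner c) :=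
  fun _ _ c hΩ hδ hA hB => ⟨isZdAdmissible_rot hΩ hδ hA hB, isStartCorner_rot_iff hΩ hδ hA hB c⟩

end Summit.CriticalPhenomena.CardyFormulaZ2.Cruxes.LagHandOff.HittingTournament

end
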